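import Summits.QuantumAdvantage.AdviceFreeQNC0.ProductClassExtension
import HarnessLib

/-!
# Cell qa-qnc0 (rung F-Q1, route RingFrame, crux α `RingToElim`): the cell parity obstruction —
# Steps 1–3 (slices, globalisation, anti-diagonal constants)

Data on a window content `w = x ++ z` (`x ∈ {0,1}^L`, `z ∈ {0,1}^M`; `i = |x| mod 3`,
`j = |z| mod 3`, `ρ = i + j`, `σ = 2i + j mod 3`): a triple `Φ_r` of Boolean functions of
`𝔽₂`-degree `≤ D` on `{0,1}^{L+M}`, ARBITRARY triples `A_r` on `{0,1}^L`, `B_r` on `{0,1}^M`,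
constants `m_r`, and the win bit `W` of the CELL GAME, `W(x ++ z) = Φ_ρ(w) ⊕ m_σ ⊕ A_ρ(x) ⊕ B_σ(z)`
(the section hypothesis `hW`).  Assuming the failure set `{W = 0}` has `≤ ε·2^{L+M}` points:

* `cellParity_row_approx` / `cellParity_col_approx` — Step 1: a light row `z₀` of class `j`
  (`exists_row_le`) exhibits `A_ρ` on the class `i` as the degree-`≤ D` slice
  `α(x) = ¬(Φ_ρ(x ++ z₀) ⊕ m_σ ⊕ B_σ(z₀))` up to `4ε·2^L` points; columns symmetrically;
* `cellParity_globalise` — Step 2: the degree-`≤ D` identity `Φ_ρ = ¬(m_σ ⊕ α(x) ⊕ β(z))` holds on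
  the cell `(i, j)` off `9ε·2^{L+M}` points, hence (two-dimensional robust Hegedűs,
  `lowDeg_cell_extension`, passed as a hypothesis) off `γ·2^{L+M}` points of the whole cube;
* `cellParity_antidiag_const` — Step 3: two cells of one anti-diagonal share `Φ_ρ`, so their
  slices differ by ONE constant: `α_ij ≈ α_0ρ ⊕ a`, `β_ij ≈ β_0ρ ⊕ m_σ ⊕ m_ρ ⊕ a`
  (`exists_const_of_xor_small`).

Plus small counting tools in real form.  Step 4 and the theorem: `CellParityObstruction.lean`.
The cell's statements (prover qn-prover-3, 2026-08-27); not in print.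
WHAT THIS IS NOT: no walk strategies here; no separation.
-/

noncomputable section

namespace Summit.QuantumAdvantage.AdviceFreeQNC0

open Finset
open Literature.Computability.MetaComplexity Literature.Computability.MetaComplexity.Smolensky

variable {L M D : ℕ}

/-! ### Pure Boolean bookkeeping -/

/-- From `P ⊕ m ⊕ a ⊕ b = 1`, the bit `a` is `¬(P ⊕ m ⊕ b)`. -/
theorem xor4_solve (P mm a b : Bool) (h : xor P (xor mm (xor a b)) = true) :
    a = !(xor P (xor mm b)) := by
  revert h; cases P <;> cases mm <;> cases a <;> cases b <;> decide

/-! ### Counting tools -/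

/-- A union bound over three alternatives (real form). -/
theorem card_filter_or3_le_real {α : Type*} [Fintype α] [DecidableEq α] (P : ℕ → α → Prop)
    [∀ k, DecidablePred (P k)] :
    ((univ.filter fun x : α => P 0 x ∨ P 1 x ∨ P 2 x).card : ℝ) ≤
      ((univ.filter fun x => P 0 x).card : ℝ) + ((univ.filter fun x => P 1 x).card : ℝ) +
        ((univ.filter fun x => P 2 x).card : ℝ) := by
  rw [Finset.filter_or, Finset.filter_or]
  have h1 := Finset.card_union_le (univ.filter fun x => P 0 x)
    ((univ.filter fun x => P 1 x) ∪ (univ.filter fun x => P 2 x))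
  have h2 := Finset.card_union_le (univ.filter fun x => P 1 x) (univ.filter fun x => P 2 x)
  have : (((univ.filter fun x => P 0 x) ∪ ((univ.filter fun x => P 1 x) ∪
      (univ.filter fun x => P 2 x))).card : ℝ) ≤
      (((univ.filter fun x => P 0 x).card + ((univ.filter fun x => P 1 x).card +
        (univ.filter fun x => P 2 x).card) : ℕ) : ℝ) := by
    exact_mod_cast h1.trans (Nat.add_le_add_left h2 _)
  push_cast at this
  linarith

/-- Two filters with pointwise implication compare in cardinality (real form). -/
theorem card_filter_mono_real {α : Type*} [Fintype α] (P Q : α → Prop) [DecidablePred P]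
    [DecidablePred Q] (h : ∀ x, P x → Q x) :
    ((univ.filter P).card : ℝ) ≤ ((univ.filter Q).card : ℝ) := by
  exact_mod_cast Finset.card_le_card (Finset.monotone_filter_right _ fun x _ hx => h x hx)

/-- A union bound for a disjunction (real form). -/
theorem card_filter_or_le_real {α : Type*} [Fintype α] [DecidableEq α] (P Q : α → Prop)
    [DecidablePred P] [DecidablePred Q] :
    ((univ.filter fun x => P x ∨ Q x).card : ℝ) ≤ ((univ.filter P).card : ℝ) + ((univ.filter Q).card : ℝ) := by
  rw [Finset.filter_or]
  exact_mod_cast Finset.card_union_le _ _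

/-! ### The setting -/

/-- Residues of a point of the cell `(i, j)`. -/
theorem cell_residues {i j : ℕ} {x : Fin L → Bool} {z : Fin M → Bool}
    (hx : wt x % 3 = i % 3) (hz : wt z % 3 = j % 3) :
    (wt x + wt z) % 3 = (i + j) % 3 ∧ (2 * wt x + wt z) % 3 = (2 * i + j) % 3 := by
  constructor <;> omega

section Setting

variable {Φ : ℕ → (Fin (L + M) → Bool) → Bool} {A : ℕ → (Fin L → Bool) → Bool}
  {B : ℕ → (Fin M → Bool) → Bool} {m : ℕ → Bool} {W : (Fin (L + M) → Bool) → Bool}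

/- The CELL FORMULA of the win bit `W`, in block coordinates, is the section hypothesis `hW`. -/
variable (hW : ∀ (x : Fin L → Bool) (z : Fin M → Bool), W (Fin.append x z) =
    xor (Φ ((wt x + wt z) % 3) (Fin.append x z))
      (xor (m ((2 * wt x + wt z) % 3)) (xor (A ((wt x + wt z) % 3) x) (B ((2 * wt x + wt z) % 3) z))))
include hW

/-- **Step 1 (rows).**  If the failure set has `≤ ε·2^{L+M}` points, then for every cell `(i, j)`
there is a degree-`≤ D` function `α` agreeing with `A_ρ` on the class `i` up to `4ε·2^L` points. -/
theorem cellParity_row_approx (hΦ : ∀ r, HasDeg (Φ r) D) (hM : 3 ≤ M)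
    {ε : ℝ} (hfail : ((univ.filter fun w : Fin (L + M) → Bool => W w = false).card : ℝ) ≤
      ε * (2 : ℝ) ^ (L + M)) (i j : ℕ) :
    ∃ α : (Fin L → Bool) → Bool, HasDeg α D ∧
      ((univ.filter fun x : Fin L → Bool =>
        wt x % 3 = i % 3 ∧ A ((i + j) % 3) x ≠ α x).card : ℝ) ≤ 4 * ε * (2 : ℝ) ^ L := by
  obtain ⟨z₀, hz₀, hrow⟩ := exists_row_le (L := L) hM (fun w => W w = false) hfail j
  refine ⟨fun x => !(xor (Φ ((i + j) % 3) (Fin.append x z₀))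
    (xor (m ((2 * i + j) % 3)) (B ((2 * i + j) % 3) z₀))), ?_, le_trans ?_ hrow⟩
  · exact hasDeg_not (hasDeg_xor (hasDeg_append_left z₀ (hΦ _)) (hasDeg_const _ D))
  · refine card_filter_mono_real _ _ fun x hx => ?_
    obtain ⟨hxi, hne⟩ := hx
    by_contra hwin
    have hwin' : W (Fin.append x z₀) = true := by
      cases hW' : W (Fin.append x z₀)
      · exact absurd hW' hwin
      · rfl
    rw [hW x z₀, (cell_residues hxi hz₀).1, (cell_residues hxi hz₀).2] at hwin'
    exact hne (xor4_solve _ _ _ _ hwin')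

/-- **Step 1 (columns).**  Symmetrically, a degree-`≤ D` function `β` agreeing with `B_σ` on the
class `j` up to `4ε·2^M` points. -/
theorem cellParity_col_approx (hΦ : ∀ r, HasDeg (Φ r) D) (hL : 3 ≤ L)
    {ε : ℝ} (hfail : ((univ.filter fun w : Fin (L + M) → Bool => W w = false).card : ℝ) ≤
      ε * (2 : ℝ) ^ (L + M)) (i j : ℕ) :
    ∃ β : (Fin M → Bool) → Bool, HasDeg β D ∧
      ((univ.filter fun z : Fin M → Bool =>
        wt z % 3 = j % 3 ∧ B ((2 * i + j) % 3) z ≠ β z).card : ℝ) ≤ 4 * ε * (2 : ℝ) ^ M := by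
  obtain ⟨x₀, hx₀, hcol⟩ := exists_col_le (M := M) hL (fun w => W w = false) hfail i
  refine ⟨fun z => !(xor (Φ ((i + j) % 3) (Fin.append x₀ z))
    (xor (m ((2 * i + j) % 3)) (A ((i + j) % 3) x₀))), ?_, le_trans ?_ hcol⟩
  · exact hasDeg_not (hasDeg_xor (hasDeg_append_right x₀ (hΦ _)) (hasDeg_const _ D))
  · refine card_filter_mono_real _ _ fun z hz => ?_
    obtain ⟨hzj, hne⟩ := hz
    by_contra hwin
    have hwin' : W (Fin.append x₀ z) = true := by
      cases hW' : W (Fin.append x₀ z)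
      · exact absurd hW' hwin
      · rfl
    rw [hW x₀ z, (cell_residues hx₀ hzj).1, (cell_residues hx₀ hzj).2] at hwin'
    have := xor4_solve (Φ ((i + j) % 3) (Fin.append x₀ z)) (m ((2 * i + j) % 3))
      (B ((2 * i + j) % 3) z) (A ((i + j) % 3) x₀) (by
        revert hwin'
        cases Φ ((i + j) % 3) (Fin.append x₀ z) <;> cases m ((2 * i + j) % 3) <;>
          cases B ((2 * i + j) % 3) z <;> cases A ((i + j) % 3) x₀ <;> decide)
    exact hne this

/-- **Step 2 (globalisation).**  With `α, β` as in Step 1 for the cell `(i, j)`, the degree-`≤ D`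
identity `Φ_ρ(w) = ¬(m_σ ⊕ α(x) ⊕ β(z))` holds on the cell off `9ε·2^{L+M}` points, hence — by the
two-dimensional robust Hegedűs lemma, supplied as the hypothesis `hT` — off `γ·2^{L+M}` points of
the whole cube. -/
theorem cellParity_globalise (hΦ : ∀ r, HasDeg (Φ r) D)
    {ε γ εT : ℝ} (h9 : 9 * ε ≤ εT)
    (hT : ∀ i j : ℕ, ∀ R : (Fin (L + M) → Bool) → Bool, HasDeg R D →
      ((univ.filter fun w : Fin (L + M) → Bool => R w = true ∧
        wt (fun i : Fin L => w (Fin.castAdd M i)) % 3 = i % 3 ∧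
        wt (fun j : Fin M => w (Fin.natAdd L j)) % 3 = j % 3).card : ℝ) ≤ εT * (2 : ℝ) ^ (L + M) →
      ((univ.filter fun w : Fin (L + M) → Bool => R w = true).card : ℝ) ≤ γ * (2 : ℝ) ^ (L + M))
    (hfail : ((univ.filter fun w : Fin (L + M) → Bool => W w = false).card : ℝ) ≤
      ε * (2 : ℝ) ^ (L + M))
    (i j : ℕ) {α : (Fin L → Bool) → Bool} {β : (Fin M → Bool) → Bool} (hα : HasDeg α D)
    (hβ : HasDeg β D)
    (hαA : ((univ.filter fun x : Fin L → Bool =>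
      wt x % 3 = i % 3 ∧ A ((i + j) % 3) x ≠ α x).card : ℝ) ≤ 4 * ε * (2 : ℝ) ^ L)
    (hβB : ((univ.filter fun z : Fin M → Bool =>
      wt z % 3 = j % 3 ∧ B ((2 * i + j) % 3) z ≠ β z).card : ℝ) ≤ 4 * ε * (2 : ℝ) ^ M) :
    ((univ.filter fun w : Fin (L + M) → Bool =>
      Φ ((i + j) % 3) w ≠ !(xor (m ((2 * i + j) % 3))
        (xor (α (fun i : Fin L => w (Fin.castAdd M i))) (β (fun j : Fin M => w (Fin.natAdd L j)))))).card
        : ℝ) ≤ γ * (2 : ℝ) ^ (L + M) := by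
  set R : (Fin (L + M) → Bool) → Bool := fun w => !(xor (Φ ((i + j) % 3) w)
    (xor (m ((2 * i + j) % 3))
      (xor (α (fun i : Fin L => w (Fin.castAdd M i))) (β (fun j : Fin M => w (Fin.natAdd L j))))))
    with hR
  have hRdeg : HasDeg R D :=
    hasDeg_not (hasDeg_xor (hΦ _) (hasDeg_xor (hasDeg_const _ D)
      (hasDeg_xor (hasDeg_leftBlock hα) (hasDeg_rightBlock hβ))))
  -- the identity fails exactly where `R = true`
  have heq : (univ.filter fun w : Fin (L + M) → Bool =>
      Φ ((i + j) % 3) w ≠ !(xor (m ((2 * i + j) % 3))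
        (xor (α (fun i : Fin L => w (Fin.castAdd M i))) (β (fun j : Fin M => w (Fin.natAdd L j)))))) =
      univ.filter fun w => R w = true := by
    refine Finset.filter_congr fun w _ => ?_
    simp only [hR]
    cases Φ ((i + j) % 3) w <;> cases m ((2 * i + j) % 3) <;>
      cases α (fun i : Fin L => w (Fin.castAdd M i)) <;>
        cases β (fun j : Fin M => w (Fin.natAdd L j)) <;> simp
  rw [heq]
  refine hT i j R hRdeg (le_trans ?_ (mul_le_mul_of_nonneg_right h9 (by positivity)))
  -- on the cell, `R = true` only at failures, bad rows or bad columns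
  have hsub : ∀ w : Fin (L + M) → Bool, (R w = true ∧
      wt (fun i : Fin L => w (Fin.castAdd M i)) % 3 = i % 3 ∧
      wt (fun j : Fin M => w (Fin.natAdd L j)) % 3 = j % 3) →
      (W w = false ∨
        ((wt (fun i : Fin L => w (Fin.castAdd M i)) % 3 = i % 3 ∧
          A ((i + j) % 3) (fun i : Fin L => w (Fin.castAdd M i)) ≠
            α (fun i : Fin L => w (Fin.castAdd M i))) ∨
        (wt (fun j : Fin M => w (Fin.natAdd L j)) % 3 = j % 3 ∧
          B ((2 * i + j) % 3) (fun j : Fin M => w (Fin.natAdd L j)) ≠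
            β (fun j : Fin M => w (Fin.natAdd L j))))) := by
    intro w ⟨hRw, hxi, hzj⟩
    by_contra hcon
    push Not at hcon
    obtain ⟨hWw, hAα, hBβ⟩ := hcon
    have hWt : W w = true := by
      cases h' : W w
      · exact absurd h' hWw
      · rfl
    have hform := hW (fun i : Fin L => w (Fin.castAdd M i)) (fun j : Fin M => w (Fin.natAdd L j))
    rw [Fin.append_castAdd_natAdd] at hform
    rw [hform, (cell_residues hxi hzj).1, (cell_residues hxi hzj).2, hAα hxi, hBβ hzj] at hWt
    simp only [hR] at hRw
    revert hRw hWt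
    cases Φ ((i + j) % 3) w <;> cases m ((2 * i + j) % 3) <;>
      cases α (fun i : Fin L => w (Fin.castAdd M i)) <;>
        cases β (fun j : Fin M => w (Fin.natAdd L j)) <;> simp
  have h1 := card_filter_mono_real _ _ hsub
  -- union bound for the three alternatives
  have hU : ((univ.filter fun w : Fin (L + M) → Bool => W w = false ∨
      ((wt (fun i : Fin L => w (Fin.castAdd M i)) % 3 = i % 3 ∧
          A ((i + j) % 3) (fun i : Fin L => w (Fin.castAdd M i)) ≠
            α (fun i : Fin L => w (Fin.castAdd M i))) ∨
        (wt (fun j : Fin M => w (Fin.natAdd L j)) % 3 = j % 3 ∧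
          B ((2 * i + j) % 3) (fun j : Fin M => w (Fin.natAdd L j)) ≠
            β (fun j : Fin M => w (Fin.natAdd L j))))).card : ℝ) ≤
      ((univ.filter fun w : Fin (L + M) → Bool => W w = false).card : ℝ) +
      ((univ.filter fun w : Fin (L + M) → Bool =>
        wt (fun i : Fin L => w (Fin.castAdd M i)) % 3 = i % 3 ∧
          A ((i + j) % 3) (fun i : Fin L => w (Fin.castAdd M i)) ≠
            α (fun i : Fin L => w (Fin.castAdd M i))).card : ℝ) +
      ((univ.filter fun w : Fin (L + M) → Bool =>
        wt (fun j : Fin M => w (Fin.natAdd L j)) % 3 = j % 3 ∧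
          B ((2 * i + j) % 3) (fun j : Fin M => w (Fin.natAdd L j)) ≠
            β (fun j : Fin M => w (Fin.natAdd L j))).card : ℝ) := by
    have ha := card_filter_or_le_real (fun w : Fin (L + M) → Bool => W w = false)
      (fun w : Fin (L + M) → Bool =>
        ((wt (fun i : Fin L => w (Fin.castAdd M i)) % 3 = i % 3 ∧
          A ((i + j) % 3) (fun i : Fin L => w (Fin.castAdd M i)) ≠
            α (fun i : Fin L => w (Fin.castAdd M i))) ∨
        (wt (fun j : Fin M => w (Fin.natAdd L j)) % 3 = j % 3 ∧
          B ((2 * i + j) % 3) (fun j : Fin M => w (Fin.natAdd L j)) ≠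
            β (fun j : Fin M => w (Fin.natAdd L j)))))
    have hb := card_filter_or_le_real
      (fun w : Fin (L + M) → Bool =>
        wt (fun i : Fin L => w (Fin.castAdd M i)) % 3 = i % 3 ∧
          A ((i + j) % 3) (fun i : Fin L => w (Fin.castAdd M i)) ≠
            α (fun i : Fin L => w (Fin.castAdd M i)))
      (fun w : Fin (L + M) → Bool =>
        wt (fun j : Fin M => w (Fin.natAdd L j)) % 3 = j % 3 ∧
          B ((2 * i + j) % 3) (fun j : Fin M => w (Fin.natAdd L j)) ≠
            β (fun j : Fin M => w (Fin.natAdd L j)))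
    linarith
  -- the two product counts
  have hA' : ((univ.filter fun w : Fin (L + M) → Bool =>
      wt (fun i : Fin L => w (Fin.castAdd M i)) % 3 = i % 3 ∧
        A ((i + j) % 3) (fun i : Fin L => w (Fin.castAdd M i)) ≠
          α (fun i : Fin L => w (Fin.castAdd M i))).card : ℝ) ≤ 4 * ε * (2 : ℝ) ^ (L + M) := by
    rw [card_filter_leftBlock (fun x : Fin L → Bool => wt x % 3 = i % 3 ∧ A ((i + j) % 3) x ≠ α x)]
    push_cast
    rw [pow_add]
    nlinarith [pow_pos (show (0:ℝ) < 2 by norm_num) M]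
  have hB' : ((univ.filter fun w : Fin (L + M) → Bool =>
      wt (fun j : Fin M => w (Fin.natAdd L j)) % 3 = j % 3 ∧
        B ((2 * i + j) % 3) (fun j : Fin M => w (Fin.natAdd L j)) ≠
          β (fun j : Fin M => w (Fin.natAdd L j))).card : ℝ) ≤ 4 * ε * (2 : ℝ) ^ (L + M) := by
    rw [card_filter_rightBlock (fun z : Fin M → Bool => wt z % 3 = j % 3 ∧ B ((2 * i + j) % 3) z ≠ β z)]
    push_cast
    rw [pow_add]
    nlinarith [pow_pos (show (0:ℝ) < 2 by norm_num) L]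
  linarith

omit hW in
/-- **Step 3 (anti-diagonal constants).**  If the global identities of the cells `(i, j)` and
`(0, ρ)` (same `ρ = i + j`, and `σ(0, ρ) = ρ`) each fail on `≤ γ·2^{L+M}` points, `2γ ≤ 1/4`,
then for ONE constant `a`: `α_ij ≈ α_0ρ ⊕ a` off `2γ·2^L` points and
`β_ij ≈ β_0ρ ⊕ m_σ ⊕ m_ρ ⊕ a` off `2γ·2^M` points. -/
theorem cellParity_antidiag_const {γ : ℝ} (hγ : 2 * γ ≤ 1 / 4) (i j : ℕ)
    {α αr : (Fin L → Bool) → Bool} {β βr : (Fin M → Bool) → Bool}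
    (hG : ((univ.filter fun w : Fin (L + M) → Bool =>
      Φ ((i + j) % 3) w ≠ !(xor (m ((2 * i + j) % 3))
        (xor (α (fun i : Fin L => w (Fin.castAdd M i))) (β (fun j : Fin M => w (Fin.natAdd L j)))))).card
        : ℝ) ≤ γ * (2 : ℝ) ^ (L + M))
    (hGr : ((univ.filter fun w : Fin (L + M) → Bool =>
      Φ ((i + j) % 3) w ≠ !(xor (m ((i + j) % 3))
        (xor (αr (fun i : Fin L => w (Fin.castAdd M i))) (βr (fun j : Fin M => w (Fin.natAdd L j)))))).card
        : ℝ) ≤ γ * (2 : ℝ) ^ (L + M)) :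
    ∃ a : Bool, ((univ.filter fun x : Fin L → Bool => xor (α x) (αr x) ≠ a).card : ℝ) ≤
        2 * γ * (2 : ℝ) ^ L ∧
      ((univ.filter fun z : Fin M → Bool =>
        xor (xor (β z) (βr z)) (xor (m ((2 * i + j) % 3)) (m ((i + j) % 3))) ≠ a).card : ℝ) ≤
        2 * γ * (2 : ℝ) ^ M := by
  refine exists_const_of_xor_small (fun x => xor (α x) (αr x))
    (fun z => xor (xor (β z) (βr z)) (xor (m ((2 * i + j) % 3)) (m ((i + j) % 3)))) hγ ?_
  have hsub : ∀ w : Fin (L + M) → Bool,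
      xor ((fun x => xor (α x) (αr x)) (fun i : Fin L => w (Fin.castAdd M i)))
        ((fun z => xor (xor (β z) (βr z)) (xor (m ((2 * i + j) % 3)) (m ((i + j) % 3))))
          (fun j : Fin M => w (Fin.natAdd L j))) = true →
      (Φ ((i + j) % 3) w ≠ !(xor (m ((2 * i + j) % 3))
        (xor (α (fun i : Fin L => w (Fin.castAdd M i))) (β (fun j : Fin M => w (Fin.natAdd L j))))) ∨
      Φ ((i + j) % 3) w ≠ !(xor (m ((i + j) % 3))
        (xor (αr (fun i : Fin L => w (Fin.castAdd M i))) (βr (fun j : Fin M => w (Fin.natAdd L j)))))) := by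
    intro w hw
    by_contra hcon
    push Not at hcon
    obtain ⟨h1, h2⟩ := hcon
    rw [h1] at h2
    revert hw h2
    simp only
    cases m ((2 * i + j) % 3) <;> cases m ((i + j) % 3) <;>
      cases α (fun i : Fin L => w (Fin.castAdd M i)) <;> cases αr (fun i : Fin L => w (Fin.castAdd M i)) <;>
      cases β (fun j : Fin M => w (Fin.natAdd L j)) <;> cases βr (fun j : Fin M => w (Fin.natAdd L j)) <;>
      simp
  have h1 := card_filter_mono_real _ _ hsub
  have h2 := card_filter_or_le_real
    (fun w : Fin (L + M) → Bool => Φ ((i + j) % 3) w ≠ !(xor (m ((2 * i + j) % 3))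
        (xor (α (fun i : Fin L => w (Fin.castAdd M i))) (β (fun j : Fin M => w (Fin.natAdd L j))))))
    (fun w : Fin (L + M) → Bool => Φ ((i + j) % 3) w ≠ !(xor (m ((i + j) % 3))
        (xor (αr (fun i : Fin L => w (Fin.castAdd M i))) (βr (fun j : Fin M => w (Fin.natAdd L j))))))
  linarith

end Setting

end Summit.QuantumAdvantage.AdviceFreeQNC0
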